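import Literature.AnabelianGeometry.AbsoluteAnabelian.AbsAnabProp121viiUnramifiedCocycleProofs
import Literature.NumberTheory.GaloisRepresentations.LocalKummerTorsion
import Literature.NumberTheory.GaloisRepresentations.LocalClassFieldTheoryProofs
import HarnessLib

/-!
# [AbsAnab] Prop 1.2.1 (vii), sub-DAG row L10 `ColimitClause` — the residue maps at levels
# `n ∣ N` are compatible (PROVED)

Proof-only companion of `AbsAnabProp121viiSub.lean` (abc-iut cell, sub-DAG
`plan/L4/SUBDAG-AbsAnab-Prop121vii.md`, statements holder abc-iut-w5-d198; DAG row
`AbsAnab:Prop1.2.1(vii)/L10`).  S. Mochizuki, *The Absolute Anabelian Geometry of Hyperbolic Curves*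
(2004) [AbsAnab], Prop 1.2.1 (vii) p. 11 states the compatibility of `α` with "the residue map
`H²(Kᵢ, μ_{ℚ/ℤ}(K̄ᵢ)) ⥲ ℚ/ℤ`", where `μ_{ℚ/ℤ}(K̄) = colim_n μ_n(K̄)` (p. 10, notation) along the
inclusions `μ_n ⊆ μ_N` (`n ∣ N`).  The sub-DAG types (vii) at each finite level `n`, with the residue map
pinned by the characterisation `Prop121vii.IsInvariantMap K n` (bijective, `inv(κ_n(π) ∪ χ) = 1`).
This file proves the clause that makes the level-`n` statements a statement about `μ_{ℚ/ℤ}`: the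
characterised maps form a morphism of direct systems
`(H²(G_K, μ_n), H²(incl)) → ((1/n)ℤ/ℤ ⊆ (1/N)ℤ/ℤ)`, i.e. with `ℤ/n ≅ (1/n)ℤ/ℤ`, `a ↦ a/n`:

* `Prop121vii.invariantMap_comp_muInclHom` — **row L10 PROVED**: for `n ∣ N` and residue maps
  `inv_n`, `inv_N` (`IsInvariantMap`), `inv_N (H²(μ_n ⊆ μ_N) x) = (N/n) · inv_n x` in `ℤ/N`.
  Proof (Serre, *Local Fields* XIV §1, functoriality of `inv` in the coefficients): the normalised
  unramified cocycle `g_N : G_K → Hom(μ_N, μ_N)` restricts to the normalised cocycle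
  `g_n := g_N|μ_n` at level `n`; on inhomogeneous cocycles, with ONE Kummer lift `w`, `wⁿ = π`,
  serving both levels (`w^N = π^{N/n}`), `H²(incl)(κ_n(π) ∪ g_n)` and `κ_N(π^{N/n}) ∪ g_N` are the
  SAME `2`-cocycle `(σ, τ) ↦ (g_N(στ) − g_N(σ))(σw/w)`; hence
  `H²(incl)(c_n) = (N/n) · c_N` for the canonical classes, and `c_n` generates `H²(G_K, μ_n)`.

Only theorems (the restriction `Hom(μ_N, μ_N) → Hom(μ_n, μ_n)` is produced by an existence
statement, the private `exists_resTateDual`).  HONEST FRAMING: classical local class field theory over the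
tree's continuous cohomology; kernel-checking an undisputed step.  Nothing here bears on [IUTchIII]
Cor. 3.12; "proved" refers to this classical statement only.

## References
* [MochizukiAbsAnab2004] S. Mochizuki, *The absolute anabelian geometry of hyperbolic curves* (2004),
  Prop 1.2.1 (vii) p. 11, notation p. 10.
* [SerreLocalFields1979] J.-P. Serre, *Local Fields*, GTM 67 (1979), XIV §1 (invariant map),
  XIII §3.
-/

noncomputable section

universe u

namespace Literature.AnabelianGeometry.AbsoluteAnabelian

namespace Prop121vii

open Field CategoryTheory ValuativeRel ContRepresentation
open Literature.NumberTheory.GaloisRepresentations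
open Literature.NumberTheory.GaloisRepresentations.DiscreteGaloisModule

/-! ### §1. Restriction of Tate duals along `μ_n ⊆ μ_N` -/

section Restriction

variable (K : Type u) [Field K] {n N : ℕ}

/-- `μ_n ⊆ μ_N` is injective on carriers. [folklore] -/
private theorem muInclusion_injective (hdvd : n ∣ N) : Function.Injective (muInclusion K hdvd) :=
  fun a b h => muVal_injective K n (by rw [← muVal_muInclusion K hdvd a, h, muVal_muInclusion])

/-- For `F ∈ Hom(μ_N, μ_N)` and `x ∈ μ_n ⊆ μ_N` (`n ∣ N`), `F x` is an `n`-th root of unity. [folklore] -/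
private theorem muVal_apply_muInclusion_pow (hdvd : n ∣ N) (F : TateDual K (MuCarrier K N) N)
    (x : MuCarrier K n) :
    muVal K N (MuCarrier.toAdditive.symm (F (muInclusion K hdvd x))) ^ n = 1 := by
  have hx : n • x = 0 := by
    rw [← natCast_zsmul]
    exact zsmul_muCarrier_eq_zero K n x
  rw [← muVal_nsmul, ← map_nsmul, ← map_nsmul, ← map_nsmul, hx, map_zero, map_zero, map_zero,
    muVal_zero]

/-- **Restriction `Hom(μ_N, μ_N) → Hom(μ_n, μ_n)` along `μ_n ⊆ μ_N`** (`n ∣ N`; an endomorphism of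
`μ_N` preserves the `n`-torsion `μ_n`), as a morphism of the discrete `G_K`-modules
`μ_N^∨(1) → μ_n^∨(1)`; recorded as an existence statement with its defining property
`incl (res F x) = F (incl x)`. [folklore] -/
private theorem exists_resTateDual [Finite (MuCarrier K n)] [Finite (MuCarrier K N)] (hdvd : n ∣ N) :
    ∃ res : ((mu K N).tateDual N).toTopRep ⟶ ((mu K n).tateDual n).toTopRep,
      ∀ (F : TateDual K (MuCarrier K N) N) (x : MuCarrier K n),
        muInclusion K hdvd (MuCarrier.toAdditive.symm (res.hom F x)) =
          MuCarrier.toAdditive.symm (F (muInclusion K hdvd x)) := by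
  -- the restriction of one `F`, valued in `MuCarrier K n`
  let r₀ : TateDual K (MuCarrier K N) N → MuCarrier K n → MuCarrier K n := fun F x =>
    muOfUnit K n (muVal K N (MuCarrier.toAdditive.symm (F (muInclusion K hdvd x))))
      (muVal_apply_muInclusion_pow K hdvd F x)
  have hr₀ : ∀ F x, muInclusion K hdvd (r₀ F x) =
      MuCarrier.toAdditive.symm (F (muInclusion K hdvd x)) := fun F x =>
    muVal_injective K N (by simp only [r₀, muVal_muInclusion, muVal_muOfUnit])
  have hr₀_add : ∀ F x y, r₀ F (x + y) = r₀ F x + r₀ F y := fun F x y =>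
    muInclusion_injective K hdvd (by rw [map_add, hr₀, hr₀, hr₀, map_add, map_add, map_add])
  have hr₀_add' : ∀ F G x, r₀ (F + G) x = r₀ F x + r₀ G x := fun F G x =>
    muInclusion_injective K hdvd (by rw [map_add, hr₀, hr₀, hr₀, TateDual.add_apply, map_add])
  -- as an element of `Hom(μ_n, μ_n)`
  let r : TateDual K (MuCarrier K N) N → TateDual K (MuCarrier K n) n := fun F =>
    show MuCarrier K n →+ Additive (rootsOfUnity n (AlgebraicClosure K)) from
      (MuCarrier.toAdditive (K := K) (n := n)).toAddMonoidHom.comp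
        (AddMonoidHom.mk' (r₀ F) (hr₀_add F))
  have hr : ∀ F x, MuCarrier.toAdditive.symm (r F x) = r₀ F x := fun F x => rfl
  -- additivity in `F`
  let R : TateDual K (MuCarrier K N) N →+ TateDual K (MuCarrier K n) n :=
    AddMonoidHom.mk' r fun F G => TateDual.ext fun x =>
      (MuCarrier.toAdditive (K := K) (n := n)).symm.injective (by
        rw [TateDual.add_apply, map_add, hr, hr, hr, hr₀_add'])
  have hι : ∀ (τ : absoluteGaloisGroup K) (y : MuCarrier K n),
      muInclusion K hdvd (mu K n τ y) = mu K N τ (muInclusion K hdvd y) := fun τ y =>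
    ContinuousRep.hom_comm_apply (muInclHom K hdvd) τ y
  refine ⟨TopRep.ofHom ⟨⟨R.toIntLinearMap, continuous_of_discreteTopology⟩, fun σ => ?_⟩,
    fun F x => by rw [← hr₀ F x]; rfl⟩
  refine ContinuousLinearMap.ext fun F => TateDual.ext fun x =>
    (MuCarrier.toAdditive (K := K) (n := n)).symm.injective (muInclusion_injective K hdvd ?_)
  change muInclusion K hdvd (MuCarrier.toAdditive.symm (r ((mu K N).tateDual N σ F) x)) =
    muInclusion K hdvd (MuCarrier.toAdditive.symm (((mu K n).tateDual n σ (r F)) x))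
  rw [hr, hr₀]
  change mu K N σ (MuCarrier.toAdditive.symm (F (mu K N σ⁻¹ (muInclusion K hdvd x)))) =
    muInclusion K hdvd (mu K n σ (r₀ F (mu K n σ⁻¹ x)))
  rw [hι, hr₀, hι]

end Restriction

/-! ### §2. The normalised cocycle restricts along `μ_n ⊆ μ_N` -/

section LevelChange

variable (K : Type u) [Field K] [ValuativeRel K] [TopologicalSpace K] [IsNonarchimedeanLocalField K]
  {n N : ℕ}

omit [ValuativeRel K] [TopologicalSpace K] [IsNonarchimedeanLocalField K] in
/-- A unit `x ∈ K^×` of the base field gives a `G_K`-invariant of the discrete module `K̄^×` whose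
value is `x` (every `σ ∈ G_K` fixes `K`). [folklore] -/
private theorem exists_invariant_unitsVal_eq_map (x : Kˣ) :
    ∃ u : (units K).toTopRep.ρ.invariants,
      unitsVal K (u : UnitsCarrier K) = Units.map (algebraMap K (AlgebraicClosure K) : K →* _) x := by
  refine ⟨⟨UnitsCarrier.ofUnits (Units.map (algebraMap K (AlgebraicClosure K) : K →* _) x),
    fun σ => ?_⟩, rfl⟩
  apply unitsVal_injective
  change unitsVal K (units K σ _) = _
  rw [unitsVal_apply, unitsVal_ofUnits]
  ext
  rw [Units.coe_smul, Units.coe_map, MonoidHom.coe_coe, absoluteGaloisGroup.smul_def, AlgEquiv.commutes]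

/-- **The Frobenius-normalised unramified cocycle restricts**: if `g : G_K → Hom(μ_N, μ_N)` is the
normalised unramified cocycle at level `N` (`g(σ) = χ(σ)·id`, `χ(I_K) = 0`, `χ(Frob) = 1`), then its
restriction `res ∘ g : G_K → Hom(μ_n, μ_n)` along `μ_n ⊆ μ_N` is the normalised unramified cocycle at
level `n` (with character `χ mod n`). [cite: SerreLocalFields1979, XIV §1] -/
private theorem isNormalizedUnramifiedCocycle_res [NeZero N] [Finite (MuCarrier K n)] [Finite (MuCarrier K N)]
    (hdvd : n ∣ N) (res : ((mu K N).tateDual N).toTopRep ⟶ ((mu K n).tateDual n).toTopRep)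
    (hres : ∀ (F : TateDual K (MuCarrier K N) N) (x : MuCarrier K n),
      muInclusion K hdvd (MuCarrier.toAdditive.symm (res.hom F x)) =
        MuCarrier.toAdditive.symm (F (muInclusion K hdvd x)))
    (g : contOneCocycles ((mu K N).tateDual N).toTopRep) (hg : IsNormalizedUnramifiedCocycle K N g) :
    IsNormalizedUnramifiedCocycle K n
      (contOneCocycles.pullback (ContinuousMonoidHom.id (absoluteGaloisGroup K)) (resIdHom res) g) := by
  obtain ⟨χ, hχ, hI, hF⟩ := hg
  refine ⟨fun σ => ZMod.castHom hdvd (ZMod n) (χ σ), fun σ m => ?_, fun σ hσ => by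
    show ZMod.castHom hdvd (ZMod n) (χ σ) = 0
    rw [hI σ hσ, map_zero], fun σ hσ => by
    show ZMod.castHom hdvd (ZMod n) (χ σ) = 1
    rw [hF σ hσ, map_one]⟩
  show _ = ((ZMod.castHom hdvd (ZMod n) (χ σ)).val : ℤ) • MuCarrier.toAdditive m
  have hm : n • muInclusion K hdvd m = 0 := by
    rw [← map_nsmul, ← natCast_zsmul, zsmul_muCarrier_eq_zero K n m, map_zero]
  rw [pullback_id_resIdHom_apply]
  apply (MuCarrier.toAdditive (K := K) (n := n)).symm.injective
  apply muInclusion_injective K hdvd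
  rw [hres, hχ σ (muInclusion K hdvd m), map_zsmul, map_zsmul, AddEquiv.symm_apply_apply,
    AddEquiv.symm_apply_apply, map_zsmul, ZMod.castHom_apply, ZMod.cast_eq_val, ZMod.val_natCast,
    natCast_zsmul, natCast_zsmul]
  exact nsmul_eq_mod_nsmul _ hm

/-! ### §3. Row L10: `inv_N ∘ H²(μ_n ⊆ μ_N) = (N/n) · inv_n` -/

/-- **[AbsAnab] Prop 1.2.1 (vii), sub-DAG row L10 `ColimitClause` — PROVED.**  For an MLF `K`
(valued form, characteristic `0`), levels `n ∣ N` and residue maps `inv_n : H²(G_K, μ_n) → ℤ/n`,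
`inv_N : H²(G_K, μ_N) → ℤ/N` in the sense of `Prop121vii.IsInvariantMap` (bijective,
`inv(κ(π) ∪ χ) = 1`), the map `H²(G_K, μ_n) → H²(G_K, μ_N)` induced by the inclusion `μ_n ⊆ μ_N`
(`muInclHom`) satisfies `inv_N ∘ H²(incl) = (N/n) · inv_n`; equivalently, with `ℤ/n ≅ (1/n)ℤ/ℤ ⊆ ℚ/ℤ`,
the `inv_n` assemble to the residue map `H²(G_K, μ_{ℚ/ℤ}(K̄)) = colim_n H²(G_K, μ_n) → ℚ/ℤ` of print
(functoriality of the invariant map in the coefficients, Serre, *Local Fields* XIV §1).  So the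
level-`n` statements `Prop121vii.Statement α ψ̄ n` (row L00) for all `n` are print's `μ_{ℚ/ℤ}`-form of
Prop 1.2.1 (vii). [cite: MochizukiAbsAnab2004, Prop 1.2.1 (vii) p.11] -/
theorem invariantMap_comp_muInclHom [CharZero K] [NeZero n] [NeZero N] [Finite (MuCarrier K n)]
    [Finite (MuCarrier K N)] (hdvd : n ∣ N) (inv_n : galoisCohomology (mu K n) 2 →+ ZMod n)
    (inv_N : galoisCohomology (mu K N) 2 →+ ZMod N) (hn : IsInvariantMap K n inv_n)
    (hN : IsInvariantMap K N inv_N) (x : galoisCohomology (mu K n) 2) :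
    inv_N (cohomologyMap (muInclHom K hdvd) 2 x) = (((inv_n x).val * (N / n) : ℕ) : ZMod N) := by
  haveI : CompactSpace (absoluteGaloisGroup K) := absoluteGaloisGroup_compactSpace K
  obtain ⟨hbij, hnorm⟩ := hn
  obtain ⟨-, hnormN⟩ := hN
  -- the restriction `Hom(μ_N, μ_N) → Hom(μ_n, μ_n)` and the normalised cocycles at both levels
  obtain ⟨res, hres⟩ := exists_resTateDual K hdvd
  obtain ⟨gN, hgN⟩ := exists_isNormalizedUnramifiedCocycle K N
  set gn := contOneCocycles.pullback (ContinuousMonoidHom.id (absoluteGaloisGroup K)) (resIdHom res) gN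
    with hgn_def
  have hgn : IsNormalizedUnramifiedCocycle K n gn :=
    isNormalizedUnramifiedCocycle_res K hdvd res hres gN hgN
  have hgn1 : ∀ ρ, gn.1 ρ = res.hom (gN.1 ρ) := fun ρ => rfl
  -- a uniformiser and ONE Kummer lift `w`, `wⁿ = π`, serving both levels
  obtain ⟨ϖ, hϖ⟩ := exists_units_isUniformizer (F := K)
  obtain ⟨u, hu⟩ := exists_invariant_unitsVal_eq_map K ϖ
  have huval : (unitsVal K (u : UnitsCarrier K) : AlgebraicClosure K) =
      algebraMap K (AlgebraicClosure K) (ϖ : K) := by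
    rw [hu, Units.coe_map, MonoidHom.coe_coe]
  have hSn := isSES_kummer K n (NeZero.pos n)
  have hSN := isSES_kummer K N (NeZero.pos N)
  obtain ⟨w, hw⟩ := hSn.surjective (u : UnitsCarrier K)
  obtain ⟨m, hm⟩ := hdvd
  have hmN : N / n = m := by rw [hm, Nat.mul_div_cancel_left m (NeZero.pos n)]
  have hw' : (kummerπ K N).hom w = ((m • u : (units K).toTopRep.ρ.invariants) : UnitsCarrier K) := by
    rw [kummerπ_hom_apply] at hw ⊢
    rw [AddSubmonoidClass.coe_nsmul, ← hw, hm, Nat.cast_mul, mul_comm, mul_smul, natCast_zsmul]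
  -- the canonical classes at both levels have residue `1`
  have h1 : inv_n (((mu K n).tateDualPairing n).cupProduct (hSn.δ₀ u) (oneCocycleClass _ gn)) = 1 :=
    hnorm gn hgn (ϖ : K) hϖ u huval
  have h2 : inv_N (((mu K N).tateDualPairing N).cupProduct (hSN.δ₀ u) (oneCocycleClass _ gN)) = 1 :=
    hnormN gN hgN (ϖ : K) hϖ u huval
  -- KEY: `H²(incl)(κ_n(π) ∪ g_n) = κ_N(π^m) ∪ g_N = m · (κ_N(π) ∪ g_N)` — the same `2`-cocycle
  have hkey : cohomologyMap (muInclHom K ⟨m, hm⟩) 2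
        (((mu K n).tateDualPairing n).cupProduct (hSn.δ₀ u) (oneCocycleClass _ gn)) =
      m • ((mu K N).tateDualPairing N).cupProduct (hSN.δ₀ u) (oneCocycleClass _ gN) := by
    rw [← LinearMap.smul_apply, ← map_nsmul, ← map_nsmul, hSn.δ₀_apply_eq u w hw,
      hSN.δ₀_apply_eq (m • u) w hw', ContPairing.cupProduct_oneCocycleClass_eq_twoCocycleClass,
      ContPairing.cupProduct_oneCocycleClass_eq_twoCocycleClass, cohomologyMap_twoCocycleClass]
    refine congrArg _ (Subtype.ext (ContinuousMap.ext fun p => ?_))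
    obtain ⟨σ, τ⟩ := p
    have hd : muInclusion K ⟨m, hm⟩ ((hSn.δ₀Cocycle w (by rw [hw]; exact u.2)).1 σ) =
        (hSN.δ₀Cocycle w (by rw [hw']; exact (m • u).2)).1 σ := by
      apply hSN.injective
      change (kummerι K N).hom ((muInclHom K ⟨m, hm⟩).hom _) = _
      rw [← kummerι_eq_kummerι_muInclHom, hSn.f_δ₀Cocycle_apply, hSN.f_δ₀Cocycle_apply]
    rw [pullback₂_id_resIdHom_apply, ContPairing.cupCocycle_apply, ContPairing.cupCocycle_apply, hgn1,
      hgn1, ← map_sub]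
    change muInclusion K ⟨m, hm⟩ (MuCarrier.toAdditive.symm
        (res.hom (gN.1 (σ * τ) - gN.1 σ) ((hSn.δ₀Cocycle w (by rw [hw]; exact u.2)).1 σ))) =
      MuCarrier.toAdditive.symm
        ((gN.1 (σ * τ) - gN.1 σ) ((hSN.δ₀Cocycle w (by rw [hw']; exact (m • u).2)).1 σ))
    rw [hres, hd]
  -- view the residue maps on the carrier of `H²` (definitionally the same maps)
  let ιn : continuousCohomology 2 (mu K n).toTopRep →+ ZMod n := inv_n
  let ιN : continuousCohomology 2 (mu K N).toTopRep →+ ZMod N := inv_N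
  let x' : continuousCohomology 2 (mu K n).toTopRep := x
  have h1' : ιn (((mu K n).tateDualPairing n).cupProduct (hSn.δ₀ u) (oneCocycleClass _ gn)) = 1 := h1
  have h2' : ιN (((mu K N).tateDualPairing N).cupProduct (hSN.δ₀ u) (oneCocycleClass _ gN)) = 1 := h2
  change ιN (cohomologyMap (muInclHom K ⟨m, hm⟩) 2 x') = (((ιn x').val * (N / n) : ℕ) : ZMod N)
  -- `κ_n(π) ∪ g_n` generates `H²(G_K, μ_n)`
  have hgen : x' = (ιn x').val •
      ((mu K n).tateDualPairing n).cupProduct (hSn.δ₀ u) (oneCocycleClass _ gn) :=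
    hbij.1 (by
      show ιn x' = ιn _
      rw [map_nsmul, h1', nsmul_eq_mul, mul_one, ZMod.natCast_zmod_val])
  conv_lhs => rw [hgen]
  rw [map_nsmul, map_nsmul, hkey, map_nsmul, h2', smul_smul, nsmul_one, hmN]

end LevelChange

end Prop121vii

end Literature.AnabelianGeometry.AbsoluteAnabelian

end
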